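import Summits.NavierStokesRegularity.NavierStokesRegularity.Theorems.TypeICertificateLadderTargetStrainCubeLambSplitDepletion
import Summits.NavierStokesRegularity.NavierStokesRegularity.Theorems.TypeICertificateLadderTargetStrainCubeGalilean
import HarnessLib

/-!
# Crux `Target` = `TypeICertificateLadder.NoTypeIBlowup` (stmt-NavierStokesRegularity-1217), line
# `depletion-ladder`: the split constant `(9 + 2√15)/42` is GALILEAN

`--supports stmt-NavierStokesRegularity-1217` (helper; sequel of `…StrainCubeLambSplitDepletion` in the pattern of
`…StrainCubeGalilean`, p541544). Author: STA lineage `ns-sta-19551-p1` (g11).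

Both representations of `J = ∫⟪ω, Dv ω⟫` used by the split — the Lamb pairing `∫⟪v, ω × curl ω⟫` and the
weighted integration by parts `∫|S|²N = −∫ v·div(SN)` — see `v` undifferentiated against a zero-mean field, so
`v` may be replaced by `v − c` for ANY constant vector `c` (`ω`, `S`, `Δv`, `D¹v`, `D²v` are unchanged):

* `abs_integral_stretching_le_lambSplit_galilean` — for a `C^∞` divergence-free `v : ℝ³ → ℝ³` with bounded
  gradient, `D⁰v, D¹v, D²v ∈ L²`, and any `c` with `|v − c| ≤ M`:
  `|∫⟪curl v, Dv (curl v)⟫| ≤ ((9+2√15)/42) · M · ‖curl v‖₂ · ‖∇ curl v‖₂` — the amplitude is the Chebyshev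
  radius of the range of `v`;
* `abs_integral_stretching_le_lambSplit_oscillation` — diameter form (`c = v(0)`).

Proof: `lamb_split_cube_le` for the translate `v − c` (translation bookkeeping of `…StrainCubeGalilean`:
`fderiv_translate`, `iteratedFDeriv_translate`, `pderiv_apply_translate`, `curl_translate`, `isDivFree_translate`),
the Betchov–Miller step and the `L²` identities for `v`, the constant algebra of `…LambSplitDepletion`
(`lambSplit_constant_identity`). WHAT THIS IS NOT: not a new constant beyond `(9+2√15)/42`; not the crux. [folklore]
-/

noncomputable section

open Set Function Filter Topology MeasureTheory Finset
open scoped RealInnerProductSpace ENNReal NNReal Laplacian ContDiff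
open Literature.Analysis.FluidPDE

namespace Summit.NavierStokesRegularity.NavierStokesRegularity.Theorems.DepletionLadder.StrainCube

-- the problem directory repeats the summit name (`NavierStokesRegularity/NavierStokesRegularity`)
set_option linter.dupNamespace false

open Summit.NavierStokesRegularity.NavierStokesRegularity.Theorems.RungReynoldsOne
open Summit.NavierStokesRegularity.NavierStokesRegularity.Theorems.DepletionLadder

variable {v : EuclideanSpace ℝ (Fin 3) → EuclideanSpace ℝ (Fin 3)}

/-- `curl (v − c) = curl v` as functions. [folklore] -/
theorem curl_translate_fun (c : EuclideanSpace ℝ (Fin 3)) : curl (fun y => v y - c) = curl v :=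
  funext fun x => curl_translate c x

/-- **THE SPLIT CONSTANT IS GALILEAN.** For a `C^∞` divergence-free field `v : ℝ³ → ℝ³` with `‖Dv‖ ≤ B`,
`D⁰v, D¹v, D²v ∈ L²`, and ANY constant vector `c` with `|v − c| ≤ M`:
`|∫⟪curl v, Dv (curl v)⟫| ≤ ((9 + 2√15)/42) · M · √(∫‖curl v‖²) · √(∫|∇ curl v|²_F)`. [folklore] -/
theorem abs_integral_stretching_le_lambSplit_galilean (hv : ContDiff ℝ ∞ v)
    (hdiv : VectorCalculus.IsDivFree v) (c : EuclideanSpace ℝ (Fin 3))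
    {M B : ℝ} (hM : ∀ x, ‖v x - c‖ ≤ M) (hB : ∀ x, ‖fderiv ℝ v x‖ ≤ B)
    (h0 : ∫⁻ x, ‖iteratedFDeriv ℝ 0 v x‖ₑ ^ 2 < ⊤) (h1 : ∫⁻ x, ‖iteratedFDeriv ℝ 1 v x‖ₑ ^ 2 < ⊤)
    (h2 : ∫⁻ x, ‖iteratedFDeriv ℝ 2 v x‖ₑ ^ 2 < ⊤) :
    |∫ x, ⟪curl v x, fderiv ℝ v x (curl v x)⟫| ≤
      (9 + 2 * Real.sqrt 15) / 42 * M * Real.sqrt (∫ x, ‖curl v x‖ ^ 2) *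
        Real.sqrt (∫ x, frobeniusNormSq (fderiv ℝ (curl v) x)) := by
  set s : Fin 3 → Fin 3 → EuclideanSpace ℝ (Fin 3) → ℝ :=
    fun i j y => (pderiv j (fun z => v z i) y + pderiv i (fun z => v z j) y) / 2 with hsdef
  have hs : ∀ i j y, s i j y = (pderiv j (fun z => v z i) y + pderiv i (fun z => v z j) y) / 2 :=
    fun i j y => rfl
  -- the translate `v − c` and its data
  set v' : EuclideanSpace ℝ (Fin 3) → EuclideanSpace ℝ (Fin 3) := fun y => v y - c with hv'def
  have hv' : ContDiff ℝ ∞ v' := hv.sub contDiff_const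
  have hdiv' : VectorCalculus.IsDivFree v' := isDivFree_translate hdiv c
  have hM' : ∀ x, ‖v' x‖ ≤ M := hM
  have hD' : fderiv ℝ v' = fderiv ℝ v := by rw [hv'def]; exact fderiv_translate c
  have hB' : ∀ x, ‖fderiv ℝ v' x‖ ≤ B := fun x => by rw [hD']; exact hB x
  have h1' : ∫⁻ x, ‖iteratedFDeriv ℝ 1 v' x‖ₑ ^ 2 < ⊤ := by
    rw [hv'def, iteratedFDeriv_translate c 0]; exact h1
  have h2' : ∫⁻ x, ‖iteratedFDeriv ℝ 2 v' x‖ₑ ^ 2 < ⊤ := by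
    rw [hv'def, iteratedFDeriv_translate c 1]; exact h2
  have hs' : ∀ i j y, s i j y = (pderiv j (fun z => v' z i) y + pderiv i (fun z => v' z j) y) / 2 := by
    intro i j y
    rw [hv'def, pderiv_apply_translate c i j, pderiv_apply_translate c j i]
  have hcurl' : curl v' = curl v := by rw [hv'def]; exact curl_translate_fun c
  have hM0 : 0 ≤ M := (norm_nonneg _).trans (hM 0)
  set lam : ℝ := (270 - 3 * Real.sqrt 15) / 280 with hlam
  obtain ⟨hlam0, hlam1⟩ := lambSplit_lam_bounds
  set Z := ∫ x, ‖curl v x‖ ^ 2 with hZ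
  set W := ∫ x, frobeniusNormSq (fderiv ℝ (curl v) x) with hW
  set J := ∫ x, ⟪curl v x, fderiv ℝ v x (curl v x)⟫ with hJ
  have hB0 : ∀ x, ‖v x‖ ≤ M + ‖c‖ := fun x => by
    have h' : ‖v x‖ ≤ ‖v x - c‖ + ‖c‖ := by
      simpa using norm_le_norm_sub_add (v x) c
    linarith [hM x]
  have hA := abs_integral_stretching_le_integral_cube hv hdiv hB0 hB h1 hs
  have hC := lamb_split_cube_le hv' hdiv' hM' hB' h1' h2' hs' hlam0 hlam1
  rw [hcurl', hD'] at hC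
  have e1 : ∫ x, ∑ i, ∑ j, s i j x ^ 2 = (1 / 2) * Z := integral_sumSq_sym_eq_half hv hdiv h0 h1 hs
  have e2 : ∫ x, ∑ l, ∑ i, ∑ j, pderiv l (s i j) x ^ 2 = (1 / 2) * W :=
    integral_gradSq_sym_eq_half hv hdiv h1 h2 hs
  have e3 : ∫ x, ‖curl (curl v) x‖ ^ 2 = W := by
    rw [hW, ← integral_norm_laplacian_sq_eq hv hdiv h1 h2]
    refine integral_congr_ae (Eventually.of_forall fun x => ?_)
    simp only [curl_curl_eq_neg_laplacian (hv.of_le (by norm_cast)) hdiv x, norm_neg]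
  rw [e1, e2, e3] at hC
  -- the square roots (as in `abs_integral_stretching_le_lambSplit`)
  have er : Real.sqrt ((1 - lam) ^ 2 * Z + (lam * (Real.sqrt 6 / 9)) ^ 2 * ((1 / 2) * Z)) =
      Real.sqrt 15 / 20 * Real.sqrt Z := by
    rw [hlam, lambSplit_constant_identity Z, Real.sqrt_mul (sq_nonneg _), Real.sqrt_sq (by positivity)]
  have e12 : Real.sqrt ((1 / 2) * Z) * Real.sqrt ((1 / 2) * W) = (1 / 2) * (Real.sqrt Z * Real.sqrt W) := by
    rw [Real.sqrt_mul (by norm_num) Z, Real.sqrt_mul (by norm_num) W]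
    have h12 : Real.sqrt (1 / 2) * Real.sqrt (1 / 2) = 1 / 2 := Real.mul_self_sqrt (by norm_num)
    linear_combination (Real.sqrt Z * Real.sqrt W) * h12
  have h64 : Real.sqrt 6 * Real.sqrt (2 / 3) = 2 := by
    rw [← Real.sqrt_mul (by norm_num), show (6 : ℝ) * (2 / 3) = 2 ^ 2 by norm_num,
      Real.sqrt_sq (by norm_num)]
  have hc2 : lam * |J| ≤ lam * ((2 / 9) * Real.sqrt 6 *
      ∫ x, (∑ i, ∑ j, s i j x ^ 2) * Real.sqrt (∑ i, ∑ j, s i j x ^ 2)) :=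
    mul_le_mul_of_nonneg_left hA hlam0
  have hRHS : M * (Real.sqrt W * Real.sqrt ((1 - lam) ^ 2 * Z + (lam * (Real.sqrt 6 / 9)) ^ 2 * ((1 / 2) * Z)) +
        lam * ((2 / 9) * Real.sqrt 6) * (Real.sqrt (2 / 3) *
          (Real.sqrt ((1 / 2) * Z) * Real.sqrt ((1 / 2) * W)))) =
      (9 + 2 * Real.sqrt 15) / 42 * M * Real.sqrt Z * Real.sqrt W := by
    rw [er, e12]
    have : lam * ((2 / 9) * Real.sqrt 6) * (Real.sqrt (2 / 3) * ((1 / 2) * (Real.sqrt Z * Real.sqrt W))) =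
        lam * (1 / 9) * (Real.sqrt 6 * Real.sqrt (2 / 3)) * (Real.sqrt Z * Real.sqrt W) := by ring
    rw [this, h64, hlam]
    ring
  calc |J| = (1 - lam) * |J| + lam * |J| := by ring
    _ ≤ (1 - lam) * |J| + lam * ((2 / 9) * Real.sqrt 6 *
          ∫ x, (∑ i, ∑ j, s i j x ^ 2) * Real.sqrt (∑ i, ∑ j, s i j x ^ 2)) := by linarith [hc2]
    _ = (1 - lam) * |J| + lam * ((2 / 9) * Real.sqrt 6) *
          ∫ x, (∑ i, ∑ j, s i j x ^ 2) * Real.sqrt (∑ i, ∑ j, s i j x ^ 2) := by ring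
    _ ≤ M * (Real.sqrt W * Real.sqrt ((1 - lam) ^ 2 * Z + (lam * (Real.sqrt 6 / 9)) ^ 2 * ((1 / 2) * Z)) +
        lam * ((2 / 9) * Real.sqrt 6) * (Real.sqrt (2 / 3) *
          (Real.sqrt ((1 / 2) * Z) * Real.sqrt ((1 / 2) * W)))) := hC
    _ = (9 + 2 * Real.sqrt 15) / 42 * M * Real.sqrt Z * Real.sqrt W := hRHS

/-- **Oscillation form**: if the range of `v` has diameter at most `D`, then
`|∫⟪curl v, Dv (curl v)⟫| ≤ ((9+2√15)/42) · D · ‖curl v‖₂ · ‖∇ curl v‖₂` (`c = v(0)`). [folklore] -/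
theorem abs_integral_stretching_le_lambSplit_oscillation (hv : ContDiff ℝ ∞ v)
    (hdiv : VectorCalculus.IsDivFree v)
    {D B : ℝ} (hD : ∀ x y, ‖v x - v y‖ ≤ D) (hB : ∀ x, ‖fderiv ℝ v x‖ ≤ B)
    (h0 : ∫⁻ x, ‖iteratedFDeriv ℝ 0 v x‖ₑ ^ 2 < ⊤) (h1 : ∫⁻ x, ‖iteratedFDeriv ℝ 1 v x‖ₑ ^ 2 < ⊤)
    (h2 : ∫⁻ x, ‖iteratedFDeriv ℝ 2 v x‖ₑ ^ 2 < ⊤) :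
    |∫ x, ⟪curl v x, fderiv ℝ v x (curl v x)⟫| ≤
      (9 + 2 * Real.sqrt 15) / 42 * D * Real.sqrt (∫ x, ‖curl v x‖ ^ 2) *
        Real.sqrt (∫ x, frobeniusNormSq (fderiv ℝ (curl v) x)) :=
  abs_integral_stretching_le_lambSplit_galilean hv hdiv (v 0) (fun x => hD x 0) hB h0 h1 h2

end Summit.NavierStokesRegularity.NavierStokesRegularity.Theorems.DepletionLadder.StrainCube

end
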